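import Literature.Probability.Process.StableLikeJumpChainKernel
import HarnessLib

/-!
# Killed kernels, exit masses and the first-exit decomposition

Support file for the proof of Bass–Levin 2002, Theorem 1.1
(`Literature.Probability.Process.bassLevin_thm_1_1`). Continues
`StableLikeJumpChainKernel`: for a sub-Markov kernel `K` and a set `B` we consider the kernel
killed on leaving `B`, `fun w z => B.indicator (K w) z`, its powers `R` (again carried as
recursion hypotheses `hR0`, `hR`, no new definitions), the exit mass at step `j+1` through `u`,
`∑' w, R j v w * Bᶜ.indicator (K w) u`, and the total exit mass by step `k`,
`∑ j ∈ Finset.range k, ∑' u, ∑' w, R j v w * Bᶜ.indicator (K w) u`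
(= `P_v(τ_B ≤ k)` for a Markov kernel).

Main results: mass balance (`killed_mass_le_one`, `killed_mass_eq_one`), the first-exit
decomposition (`kpow_first_exit`), far mass ≤ exit mass (`tsum_indicator_kpow_le_exit_mass`),
the discrete maximal inequality (`exit_mass_le_of_inner`), monotonicity of the exit mass in the
kernel (`exit_mass_mono_kernel`) and in the set (`exit_mass_antitone`), and the abstract
annulus-crossing lemma (`exit_mass_crossing`) which, iterated over concentric balls, replaces the
Davies-method tail bound of Bass–Levin Prop. 2.5 for chains with bounded jumps.

All statements are standard path-decomposition facts for Markov chains. [folklore]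

## References
* R. F. Bass, D. A. Levin, *Transition probabilities for symmetric jump processes*,
  Trans. Amer. Math. Soc. 354 (2002) 2933–2953, §2 (Prop. 2.5, Thm 2.8), §3 (Lemma 3.2).
-/

noncomputable section

namespace Literature.Probability.Process

open scoped BigOperators

section Exit

variable {S : Type*} [DecidableEq S] {K : S → S → ℝ} {Q : ℕ → S → S → ℝ}
  {B : Set S} {R : ℕ → S → S → ℝ}

omit [DecidableEq S] in
/-- The kernel killed outside `A` (`A.indicator (K x)`) is nonnegative. [folklore] -/
theorem killed_nonneg (hK : ∀ x y, 0 ≤ K x y) (A : Set S) (x y : S) :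
    0 ≤ A.indicator (K x) y :=
  Set.indicator_nonneg (fun z _ => hK x z) y

omit [DecidableEq S] in
/-- The killed kernel is dominated by the kernel. [folklore] -/
theorem killed_le (hK : ∀ x y, 0 ≤ K x y) (A : Set S) (x y : S) :
    A.indicator (K x) y ≤ K x y :=
  Set.indicator_le_self' (fun z _ => hK x z) y

omit [DecidableEq S] in
/-- Rows of the killed kernel are summable. [folklore] -/
theorem killed_summable (hKs : ∀ x, Summable (K x)) (A : Set S) (x : S) :
    Summable fun y => A.indicator (K x) y :=
  (hKs x).indicator A

omit [DecidableEq S] in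
/-- Rows of the killed kernel have mass at most `1`. [folklore] -/
theorem killed_tsum_le_one (hK : ∀ x y, 0 ≤ K x y) (hKs : ∀ x, Summable (K x))
    (hK1 : ∀ x, ∑' y, K x y ≤ 1) (A : Set S) (x : S) :
    ∑' y, A.indicator (K x) y ≤ 1 :=
  (Summable.tsum_le_tsum (killed_le hK A x) (killed_summable hKs A x) (hKs x)).trans (hK1 x)

omit [DecidableEq S] in
/-- The row mass of `K` splits into the parts landing in `A` and in `Aᶜ`. [folklore] -/
theorem killed_tsum_add_compl (hKs : ∀ x, Summable (K x)) (A : Set S) (x : S) :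
    ∑' y, A.indicator (K x) y + ∑' y, Aᶜ.indicator (K x) y = ∑' y, K x y := by
  rw [← Summable.tsum_add (killed_summable hKs A x) (killed_summable hKs Aᶜ x)]
  exact tsum_congr fun y => by
    rw [← Pi.add_apply (A.indicator (K x)), Set.indicator_self_add_compl]

omit [DecidableEq S] in
/-- Tonelli step used repeatedly: integrating a kernel power against a finite nonnegative measure
`ν` and then against a column `g ≤ 1` can be done in either order. [folklore] -/
theorem tsum_tsum_mul_kpow_mul {ν : S → ℝ} {g : S → ℝ} {P : S → S → ℝ}
    (hν : ∀ z, 0 ≤ ν z) (hνs : Summable ν) (hg : ∀ w, 0 ≤ g w) (hg1 : ∀ w, g w ≤ 1)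
    (hP : ∀ z w, 0 ≤ P z w) (hPs : ∀ z, Summable (P z)) (hP1 : ∀ z, ∑' w, P z w ≤ 1) :
    ∑' w, (∑' z, ν z * P z w) * g w = ∑' z, ν z * ∑' w, P z w * g w := by
  have hnn : ∀ z w, 0 ≤ ν z * (P z w * g w) :=
    fun z w => mul_nonneg (hν z) (mul_nonneg (hP z w) (hg w))
  have hle : ∀ z w, P z w * g w ≤ P z w := fun z w => mul_le_of_le_one_right (hP z w) (hg1 w)
  have h1 : ∀ z, Summable fun w => ν z * (P z w * g w) := fun z =>
    ((hPs z).mul_left (ν z)).of_nonneg_of_le (hnn z)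
      (fun w => mul_le_mul_of_nonneg_left (hle z w) (hν z))
  have h2 : Summable fun z => ∑' w, ν z * (P z w * g w) := by
    refine hνs.of_nonneg_of_le (fun z => tsum_nonneg (hnn z)) (fun z => ?_)
    rw [tsum_mul_left]
    refine mul_le_of_le_one_right (hν z) ?_
    exact (Summable.tsum_le_tsum (hle z) ((hPs z).of_nonneg_of_le
      (fun w => mul_nonneg (hP z w) (hg w)) (hle z)) (hPs z)).trans (hP1 z)
  calc ∑' w, (∑' z, ν z * P z w) * g w = ∑' w, ∑' z, ν z * (P z w * g w) := by
        refine tsum_congr fun w => ?_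
        rw [← tsum_mul_right]
        exact tsum_congr fun z => by ring
    _ = ∑' z, ∑' w, ν z * (P z w * g w) := tsum_swap_of_nonneg hnn h1 h2
    _ = ∑' z, ν z * ∑' w, P z w * g w := tsum_congr fun z => tsum_mul_left

/-- Paths of the chain killed on leaving `B` and started in `B` stay in `B`:
`R k v w = 0` for `v ∈ B`, `w ∉ B`. [folklore] -/
theorem killed_kpow_eq_zero (hR0 : ∀ x y, R 0 x y = if x = y then 1 else 0)
    (hR : ∀ n x y, R (n + 1) x y = ∑' z, R n x z * B.indicator (K z) y)
    {v w : S} (hv : v ∈ B) (hw : w ∉ B) (k : ℕ) : R k v w = 0 := by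
  cases k with
  | zero =>
    rw [hR0]
    have : v ≠ w := fun h => hw (h ▸ hv)
    simp [this]
  | succ k =>
    rw [hR]
    simp [Set.indicator_of_notMem hw]

/-- One-step mass balance of the killed chain: new surviving mass plus newly exited mass equals
the surviving mass weighted by the row sums of `K`. [folklore] -/
theorem killed_mass_succ (hK : ∀ x y, 0 ≤ K x y) (hKs : ∀ x, Summable (K x))
    (hK1 : ∀ x, ∑' y, K x y ≤ 1)
    (hR0 : ∀ x y, R 0 x y = if x = y then 1 else 0)
    (hR : ∀ n x y, R (n + 1) x y = ∑' z, R n x z * B.indicator (K z) y) (k : ℕ) (v : S) :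
    ∑' w, R (k + 1) v w + ∑' u, ∑' w, R k v w * Bᶜ.indicator (K w) u =
      ∑' z, R k v z * ∑' w, K z w := by
  have hKB : ∀ x y, 0 ≤ B.indicator (K x) y := killed_nonneg hK B
  have hKBs : ∀ x, Summable fun y => B.indicator (K x) y := killed_summable hKs B
  have hKB1 : ∀ x, ∑' y, B.indicator (K x) y ≤ 1 := killed_tsum_le_one hK hKs hK1 B
  have hRnn : ∀ k x w, 0 ≤ R k x w := kpow_nonneg hKB hR0 hR
  have hnn1 : ∀ z w, 0 ≤ R k v z * B.indicator (K z) w := fun z w => mul_nonneg (hRnn k v z) (hKB z w)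
  have h11 : ∀ z, Summable fun w => R k v z * B.indicator (K z) w := fun z => (hKBs z).mul_left _
  have h12 : Summable fun z => ∑' w, R k v z * B.indicator (K z) w := by
    refine (kpow_summable hKB hKBs hKB1 hR0 hR k v).of_nonneg_of_le
      (fun z => tsum_nonneg (hnn1 z)) (fun z => ?_)
    rw [tsum_mul_left]; exact mul_le_of_le_one_right (hRnn k v z) (hKB1 z)
  have hsurv : ∑' w, R (k + 1) v w = ∑' z, R k v z * ∑' w, B.indicator (K z) w := by
    have : R (k + 1) v = fun w => ∑' z, R k v z * B.indicator (K z) w := by funext w; rw [hR]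
    rw [this, tsum_swap_of_nonneg hnn1 h11 h12]
    exact tsum_congr fun z => tsum_mul_left
  have hnn2 : ∀ w u, 0 ≤ R k v w * Bᶜ.indicator (K w) u :=
    fun w u => mul_nonneg (hRnn k v w) (killed_nonneg hK Bᶜ w u)
  have h21 : ∀ w, Summable fun u => R k v w * Bᶜ.indicator (K w) u :=
    fun w => (killed_summable hKs Bᶜ w).mul_left _
  have h22 : Summable fun w => ∑' u, R k v w * Bᶜ.indicator (K w) u := by
    refine (kpow_summable hKB hKBs hKB1 hR0 hR k v).of_nonneg_of_le
      (fun w => tsum_nonneg (hnn2 w)) (fun w => ?_)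
    rw [tsum_mul_left]
    exact mul_le_of_le_one_right (hRnn k v w) (killed_tsum_le_one hK hKs hK1 Bᶜ w)
  have hexit : ∑' u, ∑' w, R k v w * Bᶜ.indicator (K w) u =
      ∑' w, R k v w * ∑' u, Bᶜ.indicator (K w) u := by
    rw [tsum_swap_of_nonneg hnn2 h21 h22]
    exact tsum_congr fun w => tsum_mul_left
  have hs1 : Summable fun z => R k v z * ∑' w, B.indicator (K z) w :=
    (kpow_summable hKB hKBs hKB1 hR0 hR k v).of_nonneg_of_le
      (fun z => mul_nonneg (hRnn k v z) (tsum_nonneg (hKB z)))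
      (fun z => mul_le_of_le_one_right (hRnn k v z) (hKB1 z))
  have hs2 : Summable fun z => R k v z * ∑' w, Bᶜ.indicator (K z) w :=
    (kpow_summable hKB hKBs hKB1 hR0 hR k v).of_nonneg_of_le
      (fun z => mul_nonneg (hRnn k v z) (tsum_nonneg (killed_nonneg hK Bᶜ z)))
      (fun z => mul_le_of_le_one_right (hRnn k v z) (killed_tsum_le_one hK hKs hK1 Bᶜ z))
  rw [hsurv, hexit, ← Summable.tsum_add hs1 hs2]
  exact tsum_congr fun z => by rw [← mul_add, killed_tsum_add_compl hKs B z]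

/-- **Mass balance of the killed chain**: surviving mass after `k` steps plus the mass that has
exited `B` during the first `k` steps is at most `1` (sub-Markov kernel). The exit mass at step
`j+1` through the point `u` is `∑' w, R j v w * Bᶜ.indicator (K w) u`. [folklore] -/
theorem killed_mass_le_one (hK : ∀ x y, 0 ≤ K x y) (hKs : ∀ x, Summable (K x))
    (hK1 : ∀ x, ∑' y, K x y ≤ 1)
    (hR0 : ∀ x y, R 0 x y = if x = y then 1 else 0)
    (hR : ∀ n x y, R (n + 1) x y = ∑' z, R n x z * B.indicator (K z) y) (k : ℕ) (v : S) :
    ∑' w, R k v w +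
      ∑ j ∈ Finset.range k, ∑' u, ∑' w, R j v w * Bᶜ.indicator (K w) u ≤ 1 := by
  have hKB : ∀ x y, 0 ≤ B.indicator (K x) y := killed_nonneg hK B
  have hKBs : ∀ x, Summable fun y => B.indicator (K x) y := killed_summable hKs B
  have hKB1 : ∀ x, ∑' y, B.indicator (K x) y ≤ 1 := killed_tsum_le_one hK hKs hK1 B
  have hRnn : ∀ k x w, 0 ≤ R k x w := kpow_nonneg hKB hR0 hR
  induction k with
  | zero =>
    simp only [Finset.range_zero, Finset.sum_empty, add_zero]
    exact kpow_tsum_le_one hKB hKBs hKB1 hR0 hR 0 v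
  | succ k ih =>
    rw [Finset.sum_range_succ]
    have h := killed_mass_succ hK hKs hK1 hR0 hR k v
    have hle : ∑' z, R k v z * ∑' w, K z w ≤ ∑' w, R k v w :=
      Summable.tsum_le_tsum (fun z => mul_le_of_le_one_right (hRnn k v z) (hK1 z))
        ((kpow_summable hKB hKBs hKB1 hR0 hR k v).of_nonneg_of_le
          (fun z => mul_nonneg (hRnn k v z) (tsum_nonneg (hK z)))
          (fun z => mul_le_of_le_one_right (hRnn k v z) (hK1 z)))
        (kpow_summable hKB hKBs hKB1 hR0 hR k v)
    linarith

/-- **Mass conservation of the killed chain (Markov kernel)**: surviving mass plus exited mass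
equals `1`. [folklore] -/
theorem killed_mass_eq_one (hK : ∀ x y, 0 ≤ K x y) (hKh : ∀ x, HasSum (K x) 1)
    (hR0 : ∀ x y, R 0 x y = if x = y then 1 else 0)
    (hR : ∀ n x y, R (n + 1) x y = ∑' z, R n x z * B.indicator (K z) y) (k : ℕ) (v : S) :
    ∑' w, R k v w +
      ∑ j ∈ Finset.range k, ∑' u, ∑' w, R j v w * Bᶜ.indicator (K w) u = 1 := by
  have hKs : ∀ x, Summable (K x) := fun x => (hKh x).summable
  have hK1 : ∀ x, ∑' y, K x y ≤ 1 := fun x => ((hKh x).tsum_eq).le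
  have hKB : ∀ x y, 0 ≤ B.indicator (K x) y := killed_nonneg hK B
  induction k with
  | zero =>
    simp only [Finset.range_zero, Finset.sum_empty, add_zero]
    have h0 : R 0 v = fun y => if y = v then (1 : ℝ) else 0 := by
      funext y; rw [hR0]; by_cases h : v = y <;> simp [h, eq_comm]
    rw [h0, tsum_ite_eq]
  | succ k ih =>
    rw [Finset.sum_range_succ]
    have h := killed_mass_succ hK hKs hK1 hR0 hR k v
    have heq : ∑' z, R k v z * ∑' w, K z w = ∑' w, R k v w :=
      tsum_congr fun z => by rw [(hKh z).tsum_eq, mul_one]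
    linarith

/-- The mass that has exited `B` by step `k` is at most `1`. [folklore] -/
theorem exit_mass_le_one (hK : ∀ x y, 0 ≤ K x y) (hKs : ∀ x, Summable (K x))
    (hK1 : ∀ x, ∑' y, K x y ≤ 1)
    (hR0 : ∀ x y, R 0 x y = if x = y then 1 else 0)
    (hR : ∀ n x y, R (n + 1) x y = ∑' z, R n x z * B.indicator (K z) y) (k : ℕ) (v : S) :
    ∑ j ∈ Finset.range k, ∑' u, ∑' w, R j v w * Bᶜ.indicator (K w) u ≤ 1 := by
  have h := killed_mass_le_one hK hKs hK1 hR0 hR k v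
  have h0 : 0 ≤ ∑' w, R k v w :=
    tsum_nonneg fun w => kpow_nonneg (killed_nonneg hK B) hR0 hR k v w
  linarith

/-- Mass transported from the killed chain through the kernel killed outside `A` is nonnegative
(with `A = Bᶜ`: the exit mass through a point). [folklore] -/
theorem exit_term_nonneg (hK : ∀ x y, 0 ≤ K x y)
    (hR0 : ∀ x y, R 0 x y = if x = y then 1 else 0)
    (hR : ∀ n x y, R (n + 1) x y = ∑' z, R n x z * B.indicator (K z) y) (A : Set S) (j : ℕ)
    (v u : S) : 0 ≤ ∑' w, R j v w * A.indicator (K w) u :=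
  tsum_nonneg fun w => mul_nonneg (kpow_nonneg (killed_nonneg hK B) hR0 hR j v w)
    (killed_nonneg hK A w u)

/-- The exit mass is nonnegative. [folklore] -/
theorem exit_mass_nonneg (hK : ∀ x y, 0 ≤ K x y)
    (hR0 : ∀ x y, R 0 x y = if x = y then 1 else 0)
    (hR : ∀ n x y, R (n + 1) x y = ∑' z, R n x z * B.indicator (K z) y) (k : ℕ) (v : S) :
    0 ≤ ∑ j ∈ Finset.range k, ∑' u, ∑' w, R j v w * Bᶜ.indicator (K w) u :=
  Finset.sum_nonneg fun j _ => tsum_nonneg fun u => exit_term_nonneg hK hR0 hR Bᶜ j v u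

/-- The exit mass is monotone in the number of steps. [folklore] -/
theorem exit_mass_mono (hK : ∀ x y, 0 ≤ K x y)
    (hR0 : ∀ x y, R 0 x y = if x = y then 1 else 0)
    (hR : ∀ n x y, R (n + 1) x y = ∑' z, R n x z * B.indicator (K z) y) {k k' : ℕ}
    (hkk' : k ≤ k') (v : S) :
    ∑ j ∈ Finset.range k, ∑' u, ∑' w, R j v w * Bᶜ.indicator (K w) u ≤
      ∑ j ∈ Finset.range k', ∑' u, ∑' w, R j v w * Bᶜ.indicator (K w) u :=
  Finset.sum_le_sum_of_subset_of_nonneg (Finset.range_mono hkk')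
    (fun j _ _ => tsum_nonneg fun u => exit_term_nonneg hK hR0 hR Bᶜ j v u)

omit [DecidableEq S] in
/-- The exit mass through `u` vanishes for `u ∈ B`. [folklore] -/
theorem exit_term_eq_zero_of_mem
    (hR : ∀ n x y, R (n + 1) x y = ∑' z, R n x z * B.indicator (K z) y)
    (j : ℕ) (v : S) {u : S} (hu : u ∈ B) :
    ∑' w, R j v w * Bᶜ.indicator (K w) u = 0 := by
  have _ := hR
  have : u ∉ Bᶜ := fun h => h hu
  simp [Set.indicator_of_notMem this]

/-- Summability in `w` of `R j v w * A.indicator (K w) u`. [folklore] -/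
theorem exit_integrand_summable (hK : ∀ x y, 0 ≤ K x y) (hKs : ∀ x, Summable (K x))
    (hK1 : ∀ x, ∑' y, K x y ≤ 1)
    (hR0 : ∀ x y, R 0 x y = if x = y then 1 else 0)
    (hR : ∀ n x y, R (n + 1) x y = ∑' z, R n x z * B.indicator (K z) y) (A : Set S) (j : ℕ)
    (v u : S) : Summable fun w => R j v w * A.indicator (K w) u := by
  have hKB : ∀ x y, 0 ≤ B.indicator (K x) y := killed_nonneg hK B
  have hKBs : ∀ x, Summable fun y => B.indicator (K x) y := killed_summable hKs B
  have hKB1 : ∀ x, ∑' y, B.indicator (K x) y ≤ 1 := killed_tsum_le_one hK hKs hK1 B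
  have hRnn : ∀ k x w, 0 ≤ R k x w := kpow_nonneg hKB hR0 hR
  refine (kpow_summable hKB hKBs hKB1 hR0 hR j v).of_nonneg_of_le
    (fun w => mul_nonneg (hRnn j v w) (killed_nonneg hK A w u)) (fun w => ?_)
  exact mul_le_of_le_one_right (hRnn j v w)
    ((killed_le hK A w u).trans (kernel_le_one hK hKs hK1 w u))

/-- The function `u ↦ ∑' w, R j v w * A.indicator (K w) u` is summable (with `A = Bᶜ`: the exit
distribution at step `j+1`), and has mass at most `1`. [folklore] -/
theorem exit_term_summable (hK : ∀ x y, 0 ≤ K x y) (hKs : ∀ x, Summable (K x))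
    (hK1 : ∀ x, ∑' y, K x y ≤ 1)
    (hR0 : ∀ x y, R 0 x y = if x = y then 1 else 0)
    (hR : ∀ n x y, R (n + 1) x y = ∑' z, R n x z * B.indicator (K z) y) (A : Set S) (j : ℕ)
    (v : S) : (Summable fun u => ∑' w, R j v w * A.indicator (K w) u) ∧
      ∑' u, ∑' w, R j v w * A.indicator (K w) u ≤ 1 := by
  have hKB : ∀ x y, 0 ≤ B.indicator (K x) y := killed_nonneg hK B
  have hKBs : ∀ x, Summable fun y => B.indicator (K x) y := killed_summable hKs B
  have hKB1 : ∀ x, ∑' y, B.indicator (K x) y ≤ 1 := killed_tsum_le_one hK hKs hK1 B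
  have hRnn : ∀ k x w, 0 ≤ R k x w := kpow_nonneg hKB hR0 hR
  have hnn2 : ∀ w u, 0 ≤ R j v w * A.indicator (K w) u :=
    fun w u => mul_nonneg (hRnn j v w) (killed_nonneg hK A w u)
  have h21 : ∀ w, Summable fun u => R j v w * A.indicator (K w) u :=
    fun w => (killed_summable hKs A w).mul_left _
  have hle : ∀ w, ∑' u, R j v w * A.indicator (K w) u ≤ R j v w := fun w => by
    rw [tsum_mul_left]
    exact mul_le_of_le_one_right (hRnn j v w) (killed_tsum_le_one hK hKs hK1 A w)
  have h22 : Summable fun w => ∑' u, R j v w * A.indicator (K w) u :=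
    (kpow_summable hKB hKBs hKB1 hR0 hR j v).of_nonneg_of_le (fun w => tsum_nonneg (hnn2 w)) hle
  refine ⟨(summable_swap_of_nonneg hnn2 h21 h22).2, ?_⟩
  rw [tsum_swap_of_nonneg hnn2 h21 h22]
  exact (Summable.tsum_le_tsum hle h22 (kpow_summable hKB hKBs hKB1 hR0 hR j v)).trans
    (kpow_tsum_le_one hKB hKBs hKB1 hR0 hR j v)

/-- **First-exit decomposition**: for the chain with kernel `K`, decomposing according to the
first exit from `B`,
`Q n v y = R n v y + ∑_{k<n} ∑' z, (exit mass at step k+1 through z) * Q (n-1-k) z y`.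
A special case of `kpow_meyer`. [folklore] -/
theorem kpow_first_exit (hK : ∀ x y, 0 ≤ K x y) (hKs : ∀ x, Summable (K x))
    (hK1 : ∀ x, ∑' y, K x y ≤ 1)
    (hQ0 : ∀ x y, Q 0 x y = if x = y then 1 else 0)
    (hQ : ∀ n x y, Q (n + 1) x y = ∑' z, Q n x z * K z y)
    (hR0 : ∀ x y, R 0 x y = if x = y then 1 else 0)
    (hR : ∀ n x y, R (n + 1) x y = ∑' z, R n x z * B.indicator (K z) y) (n : ℕ) (v y : S) :
    Q n v y = R n v y + ∑ k ∈ Finset.range n,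
      ∑' z, (∑' w, R k v w * Bᶜ.indicator (K w) z) * Q (n - 1 - k) z y :=
  kpow_meyer (killed_nonneg hK B) (killed_nonneg hK Bᶜ)
    (fun x z => by rw [← Pi.add_apply (B.indicator (K x)), Set.indicator_self_add_compl])
    hKs hK1 hQ0 hQ hR0 hR n v y

/-- **Integrating the first-exit decomposition**: for `v ∈ B`, a set `A` disjoint from `B` and
a bound `σ` on the probability to be in `A` at times `≤ n` starting from any exit point,
`∑_{y∈A} Q n v y ≤ σ · (exit mass by step n)`. [folklore] -/
theorem tsum_indicator_kpow_le_mul_exit_mass (hK : ∀ x y, 0 ≤ K x y) (hKs : ∀ x, Summable (K x))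
    (hK1 : ∀ x, ∑' y, K x y ≤ 1)
    (hQ0 : ∀ x y, Q 0 x y = if x = y then 1 else 0)
    (hQ : ∀ n x y, Q (n + 1) x y = ∑' z, Q n x z * K z y)
    (hR0 : ∀ x y, R 0 x y = if x = y then 1 else 0)
    (hR : ∀ n x y, R (n + 1) x y = ∑' z, R n x z * B.indicator (K z) y)
    {A : Set S} (hAB : Disjoint A B) {v : S} (hv : v ∈ B) (n : ℕ) {σ : ℝ}
    (hσ : ∀ u, u ∉ B → ∀ m, m ≤ n → ∑' y, A.indicator (Q m u) y ≤ σ) :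
    ∑' y, A.indicator (Q n v) y ≤
      σ * ∑ j ∈ Finset.range n, ∑' u, ∑' w, R j v w * Bᶜ.indicator (K w) u := by
  have hQnn : ∀ k x w, 0 ≤ Q k x w := kpow_nonneg hK hQ0 hQ
  have hηnn : ∀ j z, 0 ≤ ∑' w, R j v w * Bᶜ.indicator (K w) z :=
    fun j z => exit_term_nonneg hK hR0 hR Bᶜ j v z
  have hηs : ∀ j, Summable fun z => ∑' w, R j v w * Bᶜ.indicator (K w) z :=
    fun j => (exit_term_summable hK hKs hK1 hR0 hR Bᶜ j v).1
  have hAQ : ∀ m u y, 0 ≤ A.indicator (Q m u) y := fun m u y =>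
    Set.indicator_nonneg (fun z _ => hQnn m u z) y
  have hAQle : ∀ m u y, A.indicator (Q m u) y ≤ Q m u y := fun m u y =>
    Set.indicator_le_self' (fun z _ => hQnn m u z) y
  -- pointwise: on A the killed term vanishes
  have hpt : ∀ y, A.indicator (Q n v) y ≤ ∑ k ∈ Finset.range n,
      ∑' z, (∑' w, R k v w * Bᶜ.indicator (K w) z) * A.indicator (Q (n - 1 - k) z) y := by
    intro y
    by_cases hy : y ∈ A
    · rw [Set.indicator_of_mem hy, kpow_first_exit hK hKs hK1 hQ0 hQ hR0 hR n v y,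
        killed_kpow_eq_zero hR0 hR hv (Disjoint.notMem_of_mem_left hAB hy) n, zero_add]
      refine Finset.sum_le_sum fun k _ => le_of_eq (tsum_congr fun z => ?_)
      rw [Set.indicator_of_mem hy]
    · rw [Set.indicator_of_notMem hy]
      exact Finset.sum_nonneg fun k _ => tsum_nonneg fun z => mul_nonneg (hηnn k z) (hAQ _ z y)
  -- summability facts for each k
  have hnn : ∀ k z y, 0 ≤ (∑' w, R k v w * Bᶜ.indicator (K w) z) * A.indicator (Q (n - 1 - k) z) y :=
    fun k z y => mul_nonneg (hηnn k z) (hAQ _ z y)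
  have h1 : ∀ k z, Summable fun y =>
      (∑' w, R k v w * Bᶜ.indicator (K w) z) * A.indicator (Q (n - 1 - k) z) y :=
    fun k z => ((kpow_summable hK hKs hK1 hQ0 hQ _ z).indicator A).mul_left _
  have hin1 : ∀ k z, ∑' y, A.indicator (Q (n - 1 - k) z) y ≤ 1 := fun k z =>
    (Summable.tsum_le_tsum (hAQle _ z) ((kpow_summable hK hKs hK1 hQ0 hQ _ z).indicator A)
      (kpow_summable hK hKs hK1 hQ0 hQ _ z)).trans (kpow_tsum_le_one hK hKs hK1 hQ0 hQ _ z)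
  have h2 : ∀ k, Summable fun z => ∑' y,
      (∑' w, R k v w * Bᶜ.indicator (K w) z) * A.indicator (Q (n - 1 - k) z) y := by
    intro k
    refine (hηs k).of_nonneg_of_le (fun z => tsum_nonneg (hnn k z)) (fun z => ?_)
    rw [tsum_mul_left]
    exact mul_le_of_le_one_right (hηnn k z) (hin1 k z)
  have hts : ∀ k ∈ Finset.range n, Summable fun y =>
      ∑' z, (∑' w, R k v w * Bᶜ.indicator (K w) z) * A.indicator (Q (n - 1 - k) z) y :=
    fun k _ => (summable_swap_of_nonneg (hnn k) (h1 k) (h2 k)).2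
  have hAs : Summable fun y => A.indicator (Q n v) y :=
    (kpow_summable hK hKs hK1 hQ0 hQ n v).indicator A
  -- the bound σ applies wherever the exit term is nonzero
  have hησ : ∀ k ∈ Finset.range n, ∀ z,
      (∑' w, R k v w * Bᶜ.indicator (K w) z) * ∑' y, A.indicator (Q (n - 1 - k) z) y ≤
        (∑' w, R k v w * Bᶜ.indicator (K w) z) * σ := by
    intro k hk z
    by_cases hz : z ∈ B
    · rw [exit_term_eq_zero_of_mem hR k v hz]; simp
    · exact mul_le_mul_of_nonneg_left (hσ z hz _ (by omega)) (hηnn k z)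
  calc ∑' y, A.indicator (Q n v) y
      ≤ ∑' y, ∑ k ∈ Finset.range n,
          ∑' z, (∑' w, R k v w * Bᶜ.indicator (K w) z) * A.indicator (Q (n - 1 - k) z) y :=
        Summable.tsum_le_tsum hpt hAs (summable_sum hts)
    _ = ∑ k ∈ Finset.range n, ∑' y,
          ∑' z, (∑' w, R k v w * Bᶜ.indicator (K w) z) * A.indicator (Q (n - 1 - k) z) y :=
        Summable.tsum_finsetSum hts
    _ = ∑ k ∈ Finset.range n, ∑' z,
          (∑' w, R k v w * Bᶜ.indicator (K w) z) * ∑' y, A.indicator (Q (n - 1 - k) z) y := by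
        refine Finset.sum_congr rfl fun k _ => ?_
        rw [tsum_swap_of_nonneg (hnn k) (h1 k) (h2 k)]
        exact tsum_congr fun z => tsum_mul_left
    _ ≤ ∑ k ∈ Finset.range n, ∑' z, (∑' w, R k v w * Bᶜ.indicator (K w) z) * σ := by
        refine Finset.sum_le_sum fun k hk => Summable.tsum_le_tsum (hησ k hk) ?_ ((hηs k).mul_right σ)
        refine (hηs k).of_nonneg_of_le (fun z => mul_nonneg (hηnn k z) (tsum_nonneg (hAQ _ z)))
          (fun z => mul_le_of_le_one_right (hηnn k z) (hin1 k z))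
    _ = σ * ∑ j ∈ Finset.range n, ∑' u, ∑' w, R j v w * Bᶜ.indicator (K w) u := by
        rw [Finset.mul_sum]
        exact Finset.sum_congr rfl fun k _ => by rw [tsum_mul_right, mul_comm]

/-- **Far mass is bounded by exit mass**: for `v ∈ B` and a set `A` disjoint from `B`, the mass
`∑_{y ∈ A} Q n v y` is at most the mass that exited `B` during the first `n` steps. [folklore] -/
theorem tsum_indicator_kpow_le_exit_mass (hK : ∀ x y, 0 ≤ K x y) (hKs : ∀ x, Summable (K x))
    (hK1 : ∀ x, ∑' y, K x y ≤ 1)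
    (hQ0 : ∀ x y, Q 0 x y = if x = y then 1 else 0)
    (hQ : ∀ n x y, Q (n + 1) x y = ∑' z, Q n x z * K z y)
    (hR0 : ∀ x y, R 0 x y = if x = y then 1 else 0)
    (hR : ∀ n x y, R (n + 1) x y = ∑' z, R n x z * B.indicator (K z) y)
    {A : Set S} (hAB : Disjoint A B) {v : S} (hv : v ∈ B) (n : ℕ) :
    ∑' y, A.indicator (Q n v) y ≤
      ∑ j ∈ Finset.range n, ∑' u, ∑' w, R j v w * Bᶜ.indicator (K w) u := by
  have hQnn : ∀ k x w, 0 ≤ Q k x w := kpow_nonneg hK hQ0 hQ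
  have h := tsum_indicator_kpow_le_mul_exit_mass hK hKs hK1 hQ0 hQ hR0 hR hAB hv n (σ := 1)
    (fun u _ m _ => (Summable.tsum_le_tsum (fun y => Set.indicator_le_self' (fun z _ => hQnn m u z) y)
      ((kpow_summable hK hKs hK1 hQ0 hQ m u).indicator A) (kpow_summable hK hKs hK1 hQ0 hQ m u)).trans
      (kpow_tsum_le_one hK hKs hK1 hQ0 hQ m u))
  simpa using h

/-- **Maximal inequality** (discrete Ottaviani-type bound via the first-exit decomposition): for a
Markov kernel, a set `B` and an "inner" set `A` (typically `A ⊆ B`): if from every point outside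
`B` the probability of being in `A` at any time `≤ n` is at most `σ`, then
`(1 - σ) · P_v(exit B by time n) ≤ P_v(X_n ∉ A)`. Bass–Levin use the continuous-time analogue
(proof of Prop. 2.5). [folklore] -/
theorem exit_mass_le_of_inner (hK : ∀ x y, 0 ≤ K x y) (hKh : ∀ x, HasSum (K x) 1)
    (hQ0 : ∀ x y, Q 0 x y = if x = y then 1 else 0)
    (hQ : ∀ n x y, Q (n + 1) x y = ∑' z, Q n x z * K z y)
    (hR0 : ∀ x y, R 0 x y = if x = y then 1 else 0)
    (hR : ∀ n x y, R (n + 1) x y = ∑' z, R n x z * B.indicator (K z) y)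
    {A : Set S} (v : S) (n : ℕ) {σ : ℝ}
    (hσ : ∀ u, u ∉ B → ∀ m, m ≤ n → ∑' y, A.indicator (Q m u) y ≤ σ) :
    (1 - σ) * ∑ j ∈ Finset.range n, ∑' u, ∑' w, R j v w * Bᶜ.indicator (K w) u ≤
      1 - ∑' y, A.indicator (Q n v) y := by
  have hKs : ∀ x, Summable (K x) := fun x => (hKh x).summable
  have hK1 : ∀ x, ∑' y, K x y ≤ 1 := fun x => ((hKh x).tsum_eq).le
  have hKB : ∀ x y, 0 ≤ B.indicator (K x) y := killed_nonneg hK B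
  have hKBs : ∀ x, Summable fun y => B.indicator (K x) y := killed_summable hKs B
  have hKB1 : ∀ x, ∑' y, B.indicator (K x) y ≤ 1 := killed_tsum_le_one hK hKs hK1 B
  have hQnn : ∀ k x w, 0 ≤ Q k x w := kpow_nonneg hK hQ0 hQ
  have hRnn : ∀ k x w, 0 ≤ R k x w := kpow_nonneg hKB hR0 hR
  have hηnn : ∀ j z, 0 ≤ ∑' w, R j v w * Bᶜ.indicator (K w) z :=
    fun j z => exit_term_nonneg hK hR0 hR Bᶜ j v z
  have hηs : ∀ j, Summable fun z => ∑' w, R j v w * Bᶜ.indicator (K w) z :=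
    fun j => (exit_term_summable hK hKs hK1 hR0 hR Bᶜ j v).1
  have hAQ : ∀ m u y, 0 ≤ A.indicator (Q m u) y := fun m u y =>
    Set.indicator_nonneg (fun z _ => hQnn m u z) y
  -- split A into the parts inside and outside B; the inside part is bounded by the stay mass
  -- pointwise bound
  have hpt : ∀ y, A.indicator (Q n v) y ≤ R n v y + ∑ k ∈ Finset.range n,
      ∑' z, (∑' w, R k v w * Bᶜ.indicator (K w) z) * A.indicator (Q (n - 1 - k) z) y := by
    intro y
    by_cases hy : y ∈ A
    · rw [Set.indicator_of_mem hy, kpow_first_exit hK hKs hK1 hQ0 hQ hR0 hR n v y]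
      refine add_le_add le_rfl (Finset.sum_le_sum fun k _ => le_of_eq (tsum_congr fun z => ?_))
      rw [Set.indicator_of_mem hy]
    · rw [Set.indicator_of_notMem hy]
      exact add_nonneg (hRnn n v y) (Finset.sum_nonneg fun k _ => tsum_nonneg fun z =>
        mul_nonneg (hηnn k z) (hAQ _ z y))
  have hnn : ∀ k z y, 0 ≤ (∑' w, R k v w * Bᶜ.indicator (K w) z) * A.indicator (Q (n - 1 - k) z) y :=
    fun k z y => mul_nonneg (hηnn k z) (hAQ _ z y)
  have h1 : ∀ k z, Summable fun y =>
      (∑' w, R k v w * Bᶜ.indicator (K w) z) * A.indicator (Q (n - 1 - k) z) y :=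
    fun k z => ((kpow_summable hK hKs hK1 hQ0 hQ _ z).indicator A).mul_left _
  have hAQle : ∀ m u y, A.indicator (Q m u) y ≤ Q m u y := fun m u y =>
    Set.indicator_le_self' (fun z _ => hQnn m u z) y
  have hin1 : ∀ k z, ∑' y, A.indicator (Q (n - 1 - k) z) y ≤ 1 := fun k z =>
    (Summable.tsum_le_tsum (hAQle _ z) ((kpow_summable hK hKs hK1 hQ0 hQ _ z).indicator A)
      (kpow_summable hK hKs hK1 hQ0 hQ _ z)).trans (kpow_tsum_le_one hK hKs hK1 hQ0 hQ _ z)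
  have h2 : ∀ k, Summable fun z => ∑' y,
      (∑' w, R k v w * Bᶜ.indicator (K w) z) * A.indicator (Q (n - 1 - k) z) y := by
    intro k
    refine (hηs k).of_nonneg_of_le (fun z => tsum_nonneg (hnn k z)) (fun z => ?_)
    rw [tsum_mul_left]
    exact mul_le_of_le_one_right (hηnn k z) (hin1 k z)
  have hts : ∀ k ∈ Finset.range n, Summable fun y =>
      ∑' z, (∑' w, R k v w * Bᶜ.indicator (K w) z) * A.indicator (Q (n - 1 - k) z) y :=
    fun k _ => (summable_swap_of_nonneg (hnn k) (h1 k) (h2 k)).2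
  have hAs : Summable fun y => A.indicator (Q n v) y :=
    (kpow_summable hK hKs hK1 hQ0 hQ n v).indicator A
  have hRs : Summable (R n v) := kpow_summable hKB hKBs hKB1 hR0 hR n v
  have hησ : ∀ k ∈ Finset.range n, ∀ z,
      (∑' w, R k v w * Bᶜ.indicator (K w) z) * ∑' y, A.indicator (Q (n - 1 - k) z) y ≤
        (∑' w, R k v w * Bᶜ.indicator (K w) z) * σ := by
    intro k hk z
    by_cases hz : z ∈ B
    · rw [exit_term_eq_zero_of_mem hR k v hz]; simp
    · exact mul_le_mul_of_nonneg_left (hσ z hz _ (by omega)) (hηnn k z)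
  have hmain : ∑' y, A.indicator (Q n v) y ≤ ∑' y, R n v y +
      σ * ∑ j ∈ Finset.range n, ∑' u, ∑' w, R j v w * Bᶜ.indicator (K w) u := by
    calc ∑' y, A.indicator (Q n v) y
        ≤ ∑' y, (R n v y + ∑ k ∈ Finset.range n,
            ∑' z, (∑' w, R k v w * Bᶜ.indicator (K w) z) * A.indicator (Q (n - 1 - k) z) y) :=
          Summable.tsum_le_tsum hpt hAs (hRs.add (summable_sum hts))
      _ = ∑' y, R n v y + ∑ k ∈ Finset.range n, ∑' y,
            ∑' z, (∑' w, R k v w * Bᶜ.indicator (K w) z) * A.indicator (Q (n - 1 - k) z) y := by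
          rw [Summable.tsum_add hRs (summable_sum hts), Summable.tsum_finsetSum hts]
      _ = ∑' y, R n v y + ∑ k ∈ Finset.range n, ∑' z,
            (∑' w, R k v w * Bᶜ.indicator (K w) z) * ∑' y, A.indicator (Q (n - 1 - k) z) y := by
          congr 1
          refine Finset.sum_congr rfl fun k _ => ?_
          rw [tsum_swap_of_nonneg (hnn k) (h1 k) (h2 k)]
          exact tsum_congr fun z => tsum_mul_left
      _ ≤ ∑' y, R n v y + ∑ k ∈ Finset.range n, ∑' z,
            (∑' w, R k v w * Bᶜ.indicator (K w) z) * σ := by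
          refine add_le_add le_rfl (Finset.sum_le_sum fun k hk => ?_)
          refine Summable.tsum_le_tsum (hησ k hk) ?_ ((hηs k).mul_right σ)
          exact (hηs k).of_nonneg_of_le (fun z => mul_nonneg (hηnn k z) (tsum_nonneg (hAQ _ z)))
            (fun z => mul_le_of_le_one_right (hηnn k z) (hin1 k z))
      _ = ∑' y, R n v y + σ * ∑ j ∈ Finset.range n, ∑' u, ∑' w, R j v w * Bᶜ.indicator (K w) u := by
          rw [Finset.mul_sum]
          congr 1
          exact Finset.sum_congr rfl fun k _ => by rw [tsum_mul_right, mul_comm]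
  have hmass := killed_mass_eq_one hK hKh hR0 hR n v
  nlinarith [hmain, hmass, exit_mass_nonneg hK hR0 hR n v]

omit [DecidableEq S] in
/-- Pointwise domination of killed kernels along `K ≤ K'`. [folklore] -/
theorem killed_le_killed {K' : S → S → ℝ} (hKK' : ∀ x y, K x y ≤ K' x y) (A : Set S) (x y : S) :
    A.indicator (K x) y ≤ A.indicator (K' x) y :=
  Set.indicator_le_indicator (hKK' x y)

/-- **Exit mass is monotone in the kernel**: for `0 ≤ K ≤ K'` (with `K'` sub-Markov) the mass
exiting `B` by step `k` for `K` is at most that for `K'`. [folklore] -/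
theorem exit_mass_mono_kernel {K' : S → S → ℝ} {R' : ℕ → S → S → ℝ}
    (hK : ∀ x y, 0 ≤ K x y) (hKK' : ∀ x y, K x y ≤ K' x y)
    (hK's : ∀ x, Summable (K' x)) (hK'1 : ∀ x, ∑' y, K' x y ≤ 1)
    (hR0 : ∀ x y, R 0 x y = if x = y then 1 else 0)
    (hR : ∀ n x y, R (n + 1) x y = ∑' z, R n x z * B.indicator (K z) y)
    (hR'0 : ∀ x y, R' 0 x y = if x = y then 1 else 0)
    (hR' : ∀ n x y, R' (n + 1) x y = ∑' z, R' n x z * B.indicator (K' z) y) (k : ℕ) (v : S) :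
    ∑ j ∈ Finset.range k, ∑' u, ∑' w, R j v w * Bᶜ.indicator (K w) u ≤
      ∑ j ∈ Finset.range k, ∑' u, ∑' w, R' j v w * Bᶜ.indicator (K' w) u := by
  have hK' : ∀ x y, 0 ≤ K' x y := fun x y => (hK x y).trans (hKK' x y)
  have hKs : ∀ x, Summable (K x) := fun x => (hK's x).of_nonneg_of_le (hK x) (hKK' x)
  have hK1 : ∀ x, ∑' y, K x y ≤ 1 := fun x =>
    (Summable.tsum_le_tsum (hKK' x) (hKs x) (hK's x)).trans (hK'1 x)
  have hRR' : ∀ j x w, R j x w ≤ R' j x w :=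
    kpow_mono_kernel (killed_nonneg hK B) (killed_le_killed hKK' B)
      (killed_summable hK's B) (killed_tsum_le_one hK' hK's hK'1 B) hR0 hR hR'0 hR'
  have hRnn : ∀ j x w, 0 ≤ R j x w := kpow_nonneg (killed_nonneg hK B) hR0 hR
  refine Finset.sum_le_sum fun j _ => ?_
  refine Summable.tsum_le_tsum (fun u => ?_) (exit_term_summable hK hKs hK1 hR0 hR Bᶜ j v).1
    (exit_term_summable hK' hK's hK'1 hR'0 hR' Bᶜ j v).1
  refine Summable.tsum_le_tsum (fun w => ?_) (exit_integrand_summable hK hKs hK1 hR0 hR Bᶜ j v u)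
    (exit_integrand_summable hK' hK's hK'1 hR'0 hR' Bᶜ j v u)
  exact mul_le_mul (hRR' j v w) (killed_le_killed hKK' Bᶜ w u) (killed_nonneg hK Bᶜ w u)
    ((hRnn j v w).trans (hRR' j v w))

/-- Reindexing a double sum over `i < j < k` by `(i, j-1-i)`. [folklore] -/
theorem sum_range_sum_range_reindex (F : ℕ → ℕ → ℝ) (k : ℕ) :
    ∑ j ∈ Finset.range k, ∑ i ∈ Finset.range j, F i (j - 1 - i) =
      ∑ i ∈ Finset.range k, ∑ m ∈ Finset.range (k - 1 - i), F i m := by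
  induction k with
  | zero => simp
  | succ k ih =>
    rw [Finset.sum_range_succ, ih, Finset.sum_range_succ]
    have h0 : k + 1 - 1 - k = 0 := by omega
    rw [h0, Finset.sum_range_zero, add_zero, ← Finset.sum_add_distrib]
    refine Finset.sum_congr rfl fun i hi => ?_
    have hi' : i < k := Finset.mem_range.mp hi
    have h1 : k + 1 - 1 - i = (k - 1 - i) + 1 := by omega
    rw [h1, Finset.sum_range_succ]

/-- **Two nested sets.** For `B₁ ⊆ B₂`, `v ∈ B₁`, the mass exiting `B₂` by step `k` is bounded by
decomposing at the first exit from `B₁`: a direct part (exits from `B₁` landing outside `B₂`) plus,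
for exits from `B₁` landing at `z ∈ B₂ \ B₁` at step `i+1`, the mass exiting `B₂` from `z` within
the remaining `k-1-i` steps. [folklore] -/
theorem exit_mass_two_sets {B₁ B₂ : Set S} {R₁ R₂ : ℕ → S → S → ℝ}
    (hK : ∀ x y, 0 ≤ K x y) (hKs : ∀ x, Summable (K x)) (hK1 : ∀ x, ∑' y, K x y ≤ 1)
    (hR₁0 : ∀ x y, R₁ 0 x y = if x = y then 1 else 0)
    (hR₁ : ∀ n x y, R₁ (n + 1) x y = ∑' z, R₁ n x z * B₁.indicator (K z) y)
    (hR₂0 : ∀ x y, R₂ 0 x y = if x = y then 1 else 0)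
    (hR₂ : ∀ n x y, R₂ (n + 1) x y = ∑' z, R₂ n x z * B₂.indicator (K z) y)
    (h12 : B₁ ⊆ B₂) (k : ℕ) (v : S) :
    ∑ j ∈ Finset.range k, ∑' u, ∑' w, R₂ j v w * B₂ᶜ.indicator (K w) u =
      ∑ j ∈ Finset.range k, ∑' u, ∑' w, R₁ j v w * B₂ᶜ.indicator (K w) u +
      ∑ i ∈ Finset.range k, ∑' z, (∑' w, R₁ i v w * (B₂ \ B₁).indicator (K w) z) *
        ∑ m ∈ Finset.range (k - 1 - i), ∑' u, ∑' w, R₂ m z w * B₂ᶜ.indicator (K w) u := by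
  -- the kernel killed outside B₂ and its decomposition
  have hK2 : ∀ x y, 0 ≤ B₂.indicator (K x) y := killed_nonneg hK B₂
  have hK2s : ∀ x, Summable fun y => B₂.indicator (K x) y := killed_summable hKs B₂
  have hK21 : ∀ x, ∑' y, B₂.indicator (K x) y ≤ 1 := killed_tsum_le_one hK hKs hK1 B₂
  have hsplit : ∀ x y, B₂.indicator (K x) y =
      B₁.indicator (K x) y + (B₂ \ B₁).indicator (K x) y := by
    intro x y
    have hd : Disjoint B₁ (B₂ \ B₁) := Set.disjoint_sdiff_right
    have := congrFun (Set.indicator_union_of_disjoint hd (K x)) y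
    rwa [Set.union_sdiff_cancel h12] at this
  -- R₁ is also the power sequence of the B₂-killed kernel killed outside B₁
  have hR₁' : ∀ n x y, R₁ (n + 1) x y =
      ∑' z, R₁ n x z * B₁.indicator (fun y => B₂.indicator (K z) y) y := by
    intro n x y
    rw [hR₁]
    refine tsum_congr fun z => ?_
    congr 1
    by_cases hy : y ∈ B₁
    · rw [Set.indicator_of_mem hy, Set.indicator_of_mem hy, Set.indicator_of_mem (h12 hy)]
    · rw [Set.indicator_of_notMem hy, Set.indicator_of_notMem hy]
  have hmeyer := fun j w => kpow_meyer (K := fun x y => B₂.indicator (K x) y) (Q := R₂)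
    (K₁ := fun x y => B₁.indicator (K x) y) (K₂ := fun x y => (B₂ \ B₁).indicator (K x) y)
    (R := R₁) (killed_nonneg hK B₁) (killed_nonneg hK (B₂ \ B₁)) hsplit hK2s hK21 hR₂0 hR₂
    hR₁0 hR₁ j v w
  have hR₁nn : ∀ j x w, 0 ≤ R₁ j x w := kpow_nonneg (killed_nonneg hK B₁) hR₁0 hR₁
  have hR₂nn : ∀ j x w, 0 ≤ R₂ j x w := kpow_nonneg hK2 hR₂0 hR₂
  have hK1s : ∀ x, Summable fun y => B₁.indicator (K x) y := killed_summable hKs B₁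
  have hK11 : ∀ x, ∑' y, B₁.indicator (K x) y ≤ 1 := killed_tsum_le_one hK hKs hK1 B₁
  -- θ i z := ∑' w, R₁ i v w * (B₂ \ B₁).indicator (K w) z
  have hθnn : ∀ i z, 0 ≤ ∑' w, R₁ i v w * (B₂ \ B₁).indicator (K w) z := fun i z =>
    tsum_nonneg fun w => mul_nonneg (hR₁nn i v w) (killed_nonneg hK _ w z)
  have hθs : ∀ i, Summable fun z => ∑' w, R₁ i v w * (B₂ \ B₁).indicator (K w) z := by
    intro i
    have hnn : ∀ w z, 0 ≤ R₁ i v w * (B₂ \ B₁).indicator (K w) z :=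
      fun w z => mul_nonneg (hR₁nn i v w) (killed_nonneg hK _ w z)
    have h1 : ∀ w, Summable fun z => R₁ i v w * (B₂ \ B₁).indicator (K w) z :=
      fun w => (killed_summable hKs _ w).mul_left _
    have h2 : Summable fun w => ∑' z, R₁ i v w * (B₂ \ B₁).indicator (K w) z := by
      refine (kpow_summable (killed_nonneg hK B₁) hK1s hK11 hR₁0 hR₁ i v).of_nonneg_of_le
        (fun w => tsum_nonneg (hnn w)) (fun w => ?_)
      rw [tsum_mul_left]
      exact mul_le_of_le_one_right (hR₁nn i v w) (killed_tsum_le_one hK hKs hK1 _ w)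
    exact (summable_swap_of_nonneg hnn h1 h2).2
  -- η₂ m z u := ∑' w, R₂ m z w * B₂ᶜ.indicator (K w) u
  have hgnn : ∀ u w, 0 ≤ B₂ᶜ.indicator (K w) u := fun u w => killed_nonneg hK _ w u
  have hg1 : ∀ u w, B₂ᶜ.indicator (K w) u ≤ 1 := fun u w =>
    (killed_le hK _ w u).trans (kernel_le_one hK hKs hK1 w u)
  -- Step 1: rewrite each exit term of R₂ using Meyer
  have hη : ∀ j u, ∑' w, R₂ j v w * B₂ᶜ.indicator (K w) u =
      ∑' w, R₁ j v w * B₂ᶜ.indicator (K w) u +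
      ∑ i ∈ Finset.range j, ∑' z, (∑' w, R₁ i v w * (B₂ \ B₁).indicator (K w) z) *
        ∑' w, R₂ (j - 1 - i) z w * B₂ᶜ.indicator (K w) u := by
    intro j u
    have hfun : (fun w => R₂ j v w * B₂ᶜ.indicator (K w) u) = fun w =>
        R₁ j v w * B₂ᶜ.indicator (K w) u + ∑ i ∈ Finset.range j,
          (∑' z, (∑' w', R₁ i v w' * (B₂ \ B₁).indicator (K w') z) * R₂ (j - 1 - i) z w) *
            B₂ᶜ.indicator (K w) u := by
      funext w; rw [hmeyer j w, add_mul, Finset.sum_mul]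
    have hs0 : Summable fun w => R₁ j v w * B₂ᶜ.indicator (K w) u :=
      (kpow_summable (killed_nonneg hK B₁) hK1s hK11 hR₁0 hR₁ j v).of_nonneg_of_le
        (fun w => mul_nonneg (hR₁nn j v w) (hgnn u w))
        (fun w => mul_le_of_le_one_right (hR₁nn j v w) (hg1 u w))
    have hsi : ∀ i ∈ Finset.range j, Summable fun w =>
        (∑' z, (∑' w', R₁ i v w' * (B₂ \ B₁).indicator (K w') z) * R₂ (j - 1 - i) z w) *
          B₂ᶜ.indicator (K w) u := by
      intro i _
      -- the inner function of w is a sub-probability: bounded by R₂ j v w ≤ ... use Meyer bound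
      have hle : ∀ w, (∑' z, (∑' w', R₁ i v w' * (B₂ \ B₁).indicator (K w') z) *
          R₂ (j - 1 - i) z w) ≤ R₂ j v w := by
        intro w
        rw [hmeyer j w]
        refine le_add_of_nonneg_of_le (hR₁nn j v w) ?_
        exact Finset.single_le_sum (f := fun i => ∑' z,
          (∑' w', R₁ i v w' * (B₂ \ B₁).indicator (K w') z) * R₂ (j - 1 - i) z w)
          (fun i' _ => tsum_nonneg fun z => mul_nonneg (hθnn i' z) (hR₂nn _ z w)) ‹_›
      refine (kpow_summable hK2 hK2s hK21 hR₂0 hR₂ j v).of_nonneg_of_le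
        (fun w => mul_nonneg (tsum_nonneg fun z => mul_nonneg (hθnn i z) (hR₂nn _ z w)) (hgnn u w))
        (fun w => ?_)
      calc _ ≤ R₂ j v w * B₂ᶜ.indicator (K w) u := mul_le_mul_of_nonneg_right (hle w) (hgnn u w)
        _ ≤ R₂ j v w := mul_le_of_le_one_right (hR₂nn j v w) (hg1 u w)
    rw [hfun, Summable.tsum_add hs0 (summable_sum hsi), Summable.tsum_finsetSum hsi]
    congr 1
    refine Finset.sum_congr rfl fun i _ => ?_
    exact tsum_tsum_mul_kpow_mul (hθnn i) (hθs i) (hgnn u) (hg1 u) (hR₂nn _)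
      (kpow_summable hK2 hK2s hK21 hR₂0 hR₂ _) (kpow_tsum_le_one hK2 hK2s hK21 hR₂0 hR₂ _)
  -- Step 2: sum over u
  have hηs' : ∀ m z, Summable fun u => ∑' w, R₂ m z w * B₂ᶜ.indicator (K w) u :=
    fun m z => (exit_term_summable hK hKs hK1 hR₂0 hR₂ B₂ᶜ m z).1
  have hη1 : ∀ m z, ∑' u, ∑' w, R₂ m z w * B₂ᶜ.indicator (K w) u ≤ 1 :=
    fun m z => (exit_term_summable hK hKs hK1 hR₂0 hR₂ B₂ᶜ m z).2
  have hηnn' : ∀ m z u, 0 ≤ ∑' w, R₂ m z w * B₂ᶜ.indicator (K w) u :=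
    fun m z u => exit_term_nonneg hK hR₂0 hR₂ B₂ᶜ m z u
  have hA_s : ∀ j, Summable fun u => ∑' w, R₁ j v w * B₂ᶜ.indicator (K w) u :=
    fun j => (exit_term_summable hK hKs hK1 hR₁0 hR₁ B₂ᶜ j v).1
  have hTi : ∀ j, ∀ i ∈ Finset.range j, (∀ z, Summable fun u =>
      (∑' w, R₁ i v w * (B₂ \ B₁).indicator (K w) z) *
        ∑' w, R₂ (j - 1 - i) z w * B₂ᶜ.indicator (K w) u) ∧
      Summable fun z => ∑' u, (∑' w, R₁ i v w * (B₂ \ B₁).indicator (K w) z) *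
        ∑' w, R₂ (j - 1 - i) z w * B₂ᶜ.indicator (K w) u := by
    intro j i _
    refine ⟨fun z => (hηs' _ z).mul_left _, ?_⟩
    refine (hθs i).of_nonneg_of_le (fun z => tsum_nonneg fun u => mul_nonneg (hθnn i z) (hηnn' _ z u))
      (fun z => ?_)
    rw [tsum_mul_left]
    exact mul_le_of_le_one_right (hθnn i z) (hη1 _ z)
  have hsumu : ∀ j, ∑' u, ∑' w, R₂ j v w * B₂ᶜ.indicator (K w) u =
      ∑' u, ∑' w, R₁ j v w * B₂ᶜ.indicator (K w) u +
      ∑ i ∈ Finset.range j, ∑' z, (∑' w, R₁ i v w * (B₂ \ B₁).indicator (K w) z) *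
        ∑' u, ∑' w, R₂ (j - 1 - i) z w * B₂ᶜ.indicator (K w) u := by
    intro j
    have hfun : (fun u => ∑' w, R₂ j v w * B₂ᶜ.indicator (K w) u) = fun u =>
        ∑' w, R₁ j v w * B₂ᶜ.indicator (K w) u +
        ∑ i ∈ Finset.range j, ∑' z, (∑' w, R₁ i v w * (B₂ \ B₁).indicator (K w) z) *
          ∑' w, R₂ (j - 1 - i) z w * B₂ᶜ.indicator (K w) u := by
      funext u; exact hη j u
    have hts : ∀ i ∈ Finset.range j, Summable fun u => ∑' z,
        (∑' w, R₁ i v w * (B₂ \ B₁).indicator (K w) z) *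
          ∑' w, R₂ (j - 1 - i) z w * B₂ᶜ.indicator (K w) u := by
      intro i hi
      obtain ⟨h1, h2⟩ := hTi j i hi
      exact (summable_swap_of_nonneg (fun z u => mul_nonneg (hθnn i z) (hηnn' _ z u)) h1 h2).2
    rw [hfun, Summable.tsum_add (hA_s j) (summable_sum hts), Summable.tsum_finsetSum hts]
    congr 1
    refine Finset.sum_congr rfl fun i hi => ?_
    obtain ⟨h1, h2⟩ := hTi j i hi
    rw [tsum_swap_of_nonneg (fun z u => mul_nonneg (hθnn i z) (hηnn' _ z u)) h1 h2]
    exact tsum_congr fun z => tsum_mul_left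
  -- Step 3: sum over j and reindex
  rw [Finset.sum_congr rfl fun j _ => hsumu j, Finset.sum_add_distrib]
  congr 1
  rw [sum_range_sum_range_reindex (fun i m => ∑' z,
    (∑' w, R₁ i v w * (B₂ \ B₁).indicator (K w) z) *
      ∑' u, ∑' w, R₂ m z w * B₂ᶜ.indicator (K w) u) k]
  refine Finset.sum_congr rfl fun i _ => ?_
  have hts : ∀ m ∈ Finset.range (k - 1 - i), Summable fun z =>
      (∑' w, R₁ i v w * (B₂ \ B₁).indicator (K w) z) *
        ∑' u, ∑' w, R₂ m z w * B₂ᶜ.indicator (K w) u := by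
    intro m _
    exact (hθs i).of_nonneg_of_le (fun z => mul_nonneg (hθnn i z) (tsum_nonneg (hηnn' m z)))
      (fun z => mul_le_of_le_one_right (hθnn i z) (hη1 m z))
  rw [← Summable.tsum_finsetSum hts]
  exact tsum_congr fun z => by rw [Finset.mul_sum]

/-- **Exit mass is antitone in the set**: for `B₁ ⊆ B₂` and `v ∈ B₁`, the mass exiting the larger
set `B₂` by step `k` is at most the mass exiting `B₁` by step `k`. [folklore] -/
theorem exit_mass_antitone {B₁ B₂ : Set S} {R₁ R₂ : ℕ → S → S → ℝ}
    (hK : ∀ x y, 0 ≤ K x y) (hKs : ∀ x, Summable (K x)) (hK1 : ∀ x, ∑' y, K x y ≤ 1)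
    (hR₁0 : ∀ x y, R₁ 0 x y = if x = y then 1 else 0)
    (hR₁ : ∀ n x y, R₁ (n + 1) x y = ∑' z, R₁ n x z * B₁.indicator (K z) y)
    (hR₂0 : ∀ x y, R₂ 0 x y = if x = y then 1 else 0)
    (hR₂ : ∀ n x y, R₂ (n + 1) x y = ∑' z, R₂ n x z * B₂.indicator (K z) y)
    (h12 : B₁ ⊆ B₂) (k : ℕ) (v : S) :
    ∑ j ∈ Finset.range k, ∑' u, ∑' w, R₂ j v w * B₂ᶜ.indicator (K w) u ≤
      ∑ j ∈ Finset.range k, ∑' u, ∑' w, R₁ j v w * B₁ᶜ.indicator (K w) u := by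
  rw [exit_mass_two_sets hK hKs hK1 hR₁0 hR₁ hR₂0 hR₂ h12 k v, ← Finset.sum_add_distrib]
  have hR₁nn : ∀ j x w, 0 ≤ R₁ j x w := kpow_nonneg (killed_nonneg hK B₁) hR₁0 hR₁
  have hK1s : ∀ x, Summable fun y => B₁.indicator (K x) y := killed_summable hKs B₁
  have hK11 : ∀ x, ∑' y, B₁.indicator (K x) y ≤ 1 := killed_tsum_le_one hK hKs hK1 B₁
  have hθnn : ∀ i z, 0 ≤ ∑' w, R₁ i v w * (B₂ \ B₁).indicator (K w) z := fun i z =>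
    tsum_nonneg fun w => mul_nonneg (hR₁nn i v w) (killed_nonneg hK _ w z)
  refine Finset.sum_le_sum fun j _ => ?_
  -- the B₂-exit mass from z is at most 1
  have hE1 : ∀ z, ∑ m ∈ Finset.range (k - 1 - j), ∑' u, ∑' w, R₂ m z w * B₂ᶜ.indicator (K w) u ≤ 1 :=
    fun z => exit_mass_le_one hK hKs hK1 hR₂0 hR₂ _ z
  have hEnn : ∀ z, 0 ≤ ∑ m ∈ Finset.range (k - 1 - j), ∑' u, ∑' w, R₂ m z w * B₂ᶜ.indicator (K w) u :=
    fun z => exit_mass_nonneg hK hR₂0 hR₂ _ z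
  -- summability of the u-families
  have hsA : ∀ A : Set S, Summable fun u => ∑' w, R₁ j v w * A.indicator (K w) u :=
    fun A => (exit_term_summable hK hKs hK1 hR₁0 hR₁ A j v).1
  calc ∑' u, ∑' w, R₁ j v w * B₂ᶜ.indicator (K w) u +
        ∑' z, (∑' w, R₁ j v w * (B₂ \ B₁).indicator (K w) z) *
          ∑ m ∈ Finset.range (k - 1 - j), ∑' u, ∑' w, R₂ m z w * B₂ᶜ.indicator (K w) u
      ≤ ∑' u, ∑' w, R₁ j v w * B₂ᶜ.indicator (K w) u +
        ∑' z, ∑' w, R₁ j v w * (B₂ \ B₁).indicator (K w) z := by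
        refine add_le_add le_rfl ?_
        refine Summable.tsum_le_tsum (fun z => mul_le_of_le_one_right (hθnn j z) (hE1 z)) ?_ (hsA _)
        exact (hsA _).of_nonneg_of_le (fun z => mul_nonneg (hθnn j z) (hEnn z))
          (fun z => mul_le_of_le_one_right (hθnn j z) (hE1 z))
    _ = ∑' u, ∑' w, (R₁ j v w * B₂ᶜ.indicator (K w) u + R₁ j v w * (B₂ \ B₁).indicator (K w) u) := by
        rw [← Summable.tsum_add (hsA _) (hsA _)]
        refine tsum_congr fun u => ?_
        rw [← Summable.tsum_add (exit_integrand_summable hK hKs hK1 hR₁0 hR₁ _ j v u)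
          (exit_integrand_summable hK hKs hK1 hR₁0 hR₁ _ j v u)]
    _ = ∑' u, ∑' w, R₁ j v w * B₁ᶜ.indicator (K w) u := by
        refine tsum_congr fun u => tsum_congr fun w => ?_
        rw [← mul_add]
        congr 1
        have hd : Disjoint B₂ᶜ (B₂ \ B₁) := Set.disjoint_compl_left_iff_subset.mpr Set.sdiff_subset
        have hu : B₂ᶜ ∪ (B₂ \ B₁) = B₁ᶜ := by
          ext x; constructor
          · rintro (hx | hx)
            · exact fun h1 => hx (h12 h1)
            · exact hx.2
          · intro hx
            by_cases h2 : x ∈ B₂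
            · exact Or.inr ⟨h2, hx⟩
            · exact Or.inl h2
        have := congrFun (Set.indicator_union_of_disjoint hd (K w)) u
        rw [hu] at this
        exact this.symm

/-- **Annulus-crossing lemma (abstract form).** Let `B₁ ⊆ B₁' ⊆ B₂`, suppose one step of the
chain from `B₁` cannot leave `B₁'` (`K w z = 0` for `w ∈ B₁`, `z ∉ B₁'`), and suppose that from
every point of `B₁' \ B₁` the mass exiting `B₂` within `k` steps is at most `φ`. Then for
`v ∈ B₁` the mass exiting `B₂` by step `k` is at most `φ` times the mass exiting `B₁` by step `k`.
Iterated over concentric balls this gives the geometric decay of the probability that a chain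
with jumps `≤ ρ` crosses many annuli of width `ρ` (the discrete substitute for Bass–Levin
Prop. 2.5 / Lemma 4.5). [folklore] -/
theorem exit_mass_crossing {B₁ B₁' B₂ : Set S} {R₁ R₂ : ℕ → S → S → ℝ}
    (hK : ∀ x y, 0 ≤ K x y) (hKs : ∀ x, Summable (K x)) (hK1 : ∀ x, ∑' y, K x y ≤ 1)
    (hR₁0 : ∀ x y, R₁ 0 x y = if x = y then 1 else 0)
    (hR₁ : ∀ n x y, R₁ (n + 1) x y = ∑' z, R₁ n x z * B₁.indicator (K z) y)
    (hR₂0 : ∀ x y, R₂ 0 x y = if x = y then 1 else 0)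
    (hR₂ : ∀ n x y, R₂ (n + 1) x y = ∑' z, R₂ n x z * B₂.indicator (K z) y)
    (h11' : B₁ ⊆ B₁') (h1'2 : B₁' ⊆ B₂)
    (hjump : ∀ w ∈ B₁, ∀ z, z ∉ B₁' → K w z = 0)
    {k : ℕ} {φ : ℝ} (hφ : 0 ≤ φ)
    (hφb : ∀ z ∈ B₁' \ B₁, ∀ m ≤ k,
      ∑ j ∈ Finset.range m, ∑' u, ∑' w, R₂ j z w * B₂ᶜ.indicator (K w) u ≤ φ)
    {v : S} (hv : v ∈ B₁) :
    ∑ j ∈ Finset.range k, ∑' u, ∑' w, R₂ j v w * B₂ᶜ.indicator (K w) u ≤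
      φ * ∑ j ∈ Finset.range k, ∑' u, ∑' w, R₁ j v w * B₁ᶜ.indicator (K w) u := by
  have h12 : B₁ ⊆ B₂ := h11'.trans h1'2
  rw [exit_mass_two_sets hK hKs hK1 hR₁0 hR₁ hR₂0 hR₂ h12 k v]
  have hR₁nn : ∀ j x w, 0 ≤ R₁ j x w := kpow_nonneg (killed_nonneg hK B₁) hR₁0 hR₁
  have hK1s : ∀ x, Summable fun y => B₁.indicator (K x) y := killed_summable hKs B₁
  have hK11 : ∀ x, ∑' y, B₁.indicator (K x) y ≤ 1 := killed_tsum_le_one hK hKs hK1 B₁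
  -- integrands with w ∉ B₁ vanish (paths stay in B₁), with w ∈ B₁ and target ∉ B₁' vanish (hjump)
  have hvan : ∀ (A : Set S) (j : ℕ) (u : S), u ∉ B₁' → ∀ w, R₁ j v w * A.indicator (K w) u = 0 := by
    intro A j u hu w
    by_cases hw : w ∈ B₁
    · have : K w u = 0 := hjump w hw u hu
      simp [this]
    · rw [killed_kpow_eq_zero hR₁0 hR₁ hv hw j, zero_mul]
  -- direct part vanishes
  have hdirect : ∀ j, ∑' u, ∑' w, R₁ j v w * B₂ᶜ.indicator (K w) u = 0 := by
    intro j
    have : (fun u => ∑' w, R₁ j v w * B₂ᶜ.indicator (K w) u) = fun _ => 0 := by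
      funext u
      by_cases hu : u ∈ B₂
      · have hu' : u ∉ B₂ᶜ := fun h => h hu
        simp [Set.indicator_of_notMem hu']
      · have hu' : u ∉ B₁' := fun h => hu (h1'2 h)
        rw [tsum_congr (hvan B₂ᶜ j u hu'), tsum_zero]
    rw [this, tsum_zero]
  rw [Finset.sum_congr rfl fun j _ => hdirect j, Finset.sum_const_zero, zero_add]
  -- θ i z := ∑' w, R₁ i v w * (B₂ \ B₁).indicator (K w) z vanishes unless z ∈ B₁' \ B₁
  have hθnn : ∀ i z, 0 ≤ ∑' w, R₁ i v w * (B₂ \ B₁).indicator (K w) z := fun i z =>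
    exit_term_nonneg hK hR₁0 hR₁ _ i v z
  have hθs : ∀ i, Summable fun z => ∑' w, R₁ i v w * (B₂ \ B₁).indicator (K w) z :=
    fun i => (exit_term_summable hK hKs hK1 hR₁0 hR₁ _ i v).1
  have hθzero : ∀ i z, z ∉ B₁' \ B₁ → ∑' w, R₁ i v w * (B₂ \ B₁).indicator (K w) z = 0 := by
    intro i z hz
    by_cases hz1 : z ∈ B₁
    · have hz' : z ∉ B₂ \ B₁ := fun h => h.2 hz1
      simp [Set.indicator_of_notMem hz']
    · have hz' : z ∉ B₁' := fun h => hz ⟨h, hz1⟩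
      rw [tsum_congr (hvan _ i z hz'), tsum_zero]
  have hEnn : ∀ m z, 0 ≤ ∑ j ∈ Finset.range m, ∑' u, ∑' w, R₂ j z w * B₂ᶜ.indicator (K w) u :=
    fun m z => exit_mass_nonneg hK hR₂0 hR₂ m z
  have hE1 : ∀ m z, ∑ j ∈ Finset.range m, ∑' u, ∑' w, R₂ j z w * B₂ᶜ.indicator (K w) u ≤ 1 :=
    fun m z => exit_mass_le_one hK hKs hK1 hR₂0 hR₂ m z
  -- pointwise bound by φ
  have hpt : ∀ i ∈ Finset.range k, ∀ z,
      (∑' w, R₁ i v w * (B₂ \ B₁).indicator (K w) z) *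
        ∑ m ∈ Finset.range (k - 1 - i), ∑' u, ∑' w, R₂ m z w * B₂ᶜ.indicator (K w) u ≤
      (∑' w, R₁ i v w * (B₂ \ B₁).indicator (K w) z) * φ := by
    intro i _ z
    by_cases hz : z ∈ B₁' \ B₁
    · exact mul_le_mul_of_nonneg_left (hφb z hz (k - 1 - i) (by omega)) (hθnn i z)
    · rw [hθzero i z hz]; simp
  -- θ ≤ exit kernel of B₁
  have hθle : ∀ i z, ∑' w, R₁ i v w * (B₂ \ B₁).indicator (K w) z ≤
      ∑' w, R₁ i v w * B₁ᶜ.indicator (K w) z := by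
    intro i z
    refine Summable.tsum_le_tsum (fun w => ?_) (exit_integrand_summable hK hKs hK1 hR₁0 hR₁ _ i v z)
      (exit_integrand_summable hK hKs hK1 hR₁0 hR₁ _ i v z)
    exact mul_le_mul_of_nonneg_left
      (Set.indicator_le_indicator_of_subset (Set.sdiff_subset_compl _ _) (fun _ => hK w _) z) (hR₁nn i v w)
  calc ∑ i ∈ Finset.range k, ∑' z, (∑' w, R₁ i v w * (B₂ \ B₁).indicator (K w) z) *
          ∑ m ∈ Finset.range (k - 1 - i), ∑' u, ∑' w, R₂ m z w * B₂ᶜ.indicator (K w) u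
      ≤ ∑ i ∈ Finset.range k, ∑' z, (∑' w, R₁ i v w * (B₂ \ B₁).indicator (K w) z) * φ := by
        refine Finset.sum_le_sum fun i hi => Summable.tsum_le_tsum (hpt i hi) ?_ ((hθs i).mul_right φ)
        exact (hθs i).of_nonneg_of_le (fun z => mul_nonneg (hθnn i z) (hEnn _ z))
          (fun z => mul_le_of_le_one_right (hθnn i z) (hE1 _ z))
    _ = φ * ∑ i ∈ Finset.range k, ∑' z, ∑' w, R₁ i v w * (B₂ \ B₁).indicator (K w) z := by
        rw [Finset.mul_sum]
        exact Finset.sum_congr rfl fun i _ => by rw [tsum_mul_right, mul_comm]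
    _ ≤ φ * ∑ j ∈ Finset.range k, ∑' u, ∑' w, R₁ j v w * B₁ᶜ.indicator (K w) u := by
        refine mul_le_mul_of_nonneg_left (Finset.sum_le_sum fun i _ => ?_) hφ
        exact Summable.tsum_le_tsum (hθle i) (hθs i) (exit_term_summable hK hKs hK1 hR₁0 hR₁ _ i v).1

end Exit

end Literature.Probability.Process
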